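import Literature.NumberTheory.Automorphic.FiniteAdeleWeilAssembly
import Literature.NumberTheory.Automorphic.GlobalAdditiveCharacter
import Literature.NumberTheory.GelbartRogawski1991.LocalUnitarySplittingDatum
import Literature.NumberTheory.Weil1964.AdelicMetaplecticFiniteImplementer
import HarnessLib

/-!
# Finite Heisenberg operators act factorwise on pure tensors

Junction lemma for the restricted-tensor-product assembly of the finite-adelic Schrödinger model
(Weil 1964, Chap. III n° 37–38; Mœglin–Vignéras–Waldspurger 1987, Chap. 2 I.4): for a number field `K`, a
rational Gram matrix `T ∈ M_N(K)` and a Heisenberg element `h = ((x, y), t)` of `W_𝔸 = 𝔸^N × 𝔸^N × 𝔸`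
(Gram matrix `T ⊗ 1`), the finite operator `finOp (T ⊗ 1) h = M_{(T y)_f} ∘ T_{x_f}` of the tree
(`AdelicMetaplecticFiniteImplementer`) maps the pure tensor `⊗'_v Φ_v = piProdSB Φ` of a restricted family
`Φ = (Φ_v)_v` of local Schwartz–Bruhat functions to the pure tensor of the family
`(ρ_v((x_v, y_v), 0) Φ_v)_v`, where `ρ_v = localSchrodinger K N T v` is the local Schrödinger representation of
`LocalUnitarySplittingDatum` (`finOp_piProdSB`).

On the way: the product formula `ψ_f(b) = ∏_{v ∈ S} ψ_v(b_v)` for the finite-adelic additive character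
(`finiteAdeleAddChar_eq_prod`, Tate 1967 §4.1), local components `locVec` of finite adelic vectors and their
compatibility with rational matrices (`locVec_mulVec_map`), the pointwise formula of the local Schrödinger
operators (`localSchrodinger_apply`) and the fact that `((x_v, y_v), 0)` fixes `1_{𝒪_v^N}` when `x_v` and
`T_v y_v` are integral (`localSchrodinger_unitVec`), whence the restricted family `heisFamily T h Φ`.

All statements are fully proved; no named facts.
-/

set_option autoImplicit false

noncomputable section

open scoped Classical Matrix

open IsDedekindDomain NumberField

namespace Literature.NumberTheory.Automorphic

variable (K : Type) [Field K] [NumberField K]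

/-- an additive character turns finite sums into finite products. [folklore] -/
private theorem AddChar.map_finset_sum_eq_prod {A M : Type*} [AddCommMonoid A] [CommMonoid M] (ψ : AddChar A M)
    {ι : Type*} (s : Finset ι) (f : ι → A) : ψ (∑ i ∈ s, f i) = ∏ i ∈ s, ψ (f i) := by
  induction s using Finset.induction_on with
  | empty => simp
  | insert a s ha ih => rw [Finset.sum_insert ha, Finset.prod_insert ha, AddChar.map_add_eq_mul, ih]

/-- components of a sum of finite adeles (the finite adele ring is a subring of `∏_v K_v`). [cite: Tate1967, §3.1] -/
theorem finiteAdele_add_apply (a b : FiniteAdeleRing (𝓞 K) K) (w : HeightOneSpectrum (𝓞 K)) :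
    (a + b) w = a w + b w := rfl

/-- components of a difference of finite adeles. [cite: Tate1967, §3.1] -/
theorem finiteAdele_sub_apply (a b : FiniteAdeleRing (𝓞 K) K) (w : HeightOneSpectrum (𝓞 K)) :
    (a - b) w = a w - b w := rfl

/-- components of `0`. [cite: Tate1967, §3.1] -/
theorem finiteAdele_zero_apply (w : HeightOneSpectrum (𝓞 K)) : (0 : FiniteAdeleRing (𝓞 K) K) w = 0 := rfl

/-- components of a finite sum of finite adeles. [cite: Tate1967, §3.1] -/
theorem finiteAdele_sum_apply {ι : Type*} (s : Finset ι) (f : ι → FiniteAdeleRing (𝓞 K) K)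
    (w : HeightOneSpectrum (𝓞 K)) : (∑ i ∈ s, f i) w = ∑ i ∈ s, f i w := by
  induction s using Finset.induction_on with
  | empty => rw [Finset.sum_empty, Finset.sum_empty]; rfl
  | insert a s ha ih => rw [Finset.sum_insert ha, Finset.sum_insert ha, finiteAdele_add_apply, ih]

/-- the sum of the single-place parts of `b` over `S` has the components of `b` on `S` and `0` off `S`. [cite: Tate1967, §3.1] -/
theorem sum_finiteAdeleSingleHom_apply (b : FiniteAdeleRing (𝓞 K) K) (S : Finset (HeightOneSpectrum (𝓞 K)))
    (w : HeightOneSpectrum (𝓞 K)) :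
    (∑ v ∈ S, finiteAdeleSingleHom K v (b v)) w = if w ∈ S then b w else 0 := by
  rw [finiteAdele_sum_apply]
  split_ifs with hw
  · rw [Finset.sum_eq_single_of_mem w hw (fun v _ hvw => finiteAdeleSingleHom_apply_of_ne K v (b v) (Ne.symm hvw)),
      finiteAdeleSingleHom_apply_self]
  · exact Finset.sum_eq_zero fun v hv => finiteAdeleSingleHom_apply_of_ne K v (b v) (fun h => hw (h ▸ hv))

/-- `ψ_f` through the inclusion `𝔸_f → 𝔸`. [cite: Tate1967, §4.1] -/
theorem finiteAdeleAddChar_eq_comp (b : FiniteAdeleRing (𝓞 K) K) :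
    finiteAdeleAddChar K b = adeleAddChar K (finiteAdeleInr K b) := rfl

/-- the single-place inclusion is the finite inclusion of the finite single-place inclusion. [cite: Tate1967, §3.1] -/
theorem adeleSingleHom_eq_finiteAdeleInr (v : HeightOneSpectrum (𝓞 K)) (x : v.adicCompletion K) :
    adeleSingleHom K v x = finiteAdeleInr K (finiteAdeleSingleHom K v x) := by
  rw [finiteAdeleInr_apply]
  exact Prod.ext (adeleSingleHom_apply_fst K v x) (adeleSingleHom_apply_snd K v x)

/-- `ψ` is trivial on finite adeles that are integral everywhere. [cite: Tate1967, §4.1] -/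
theorem adeleAddChar_finiteAdeleInr_eq_one {r : FiniteAdeleRing (𝓞 K) K} (hr : ∀ w, r w ∈ w.adicCompletionIntegers K) :
    adeleAddChar K (finiteAdeleInr K r) = 1 := by
  have hfi : IsFiniteIntegral K (finiteAdeleInr K r) := fun w => by rw [finiteAdeleInr_apply]; exact hr w
  have h0 : (finiteAdeleInr K r).1 = 0 := by rw [finiteAdeleInr_apply]
  rw [adeleAddChar_apply_of_isFiniteIntegral K hfi, h0, map_zero]
  simp

/-- **product formula**: `ψ_f(b) = ∏_{v ∈ S} ψ_v(b_v)` for any finite `S` outside which `b` is integral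
(`ψ_v` is trivial on `𝒪_v`). [cite: Tate1967, §4.1] -/
theorem finiteAdeleAddChar_eq_prod (b : FiniteAdeleRing (𝓞 K) K) (S : Finset (HeightOneSpectrum (𝓞 K)))
    (hS : ∀ v ∉ S, b v ∈ v.adicCompletionIntegers K) :
    finiteAdeleAddChar K b = ∏ v ∈ S, adeleAddCharAt K v (b v) := by
  set r : FiniteAdeleRing (𝓞 K) K := b - ∑ v ∈ S, finiteAdeleSingleHom K v (b v) with hr
  have hrint : ∀ w, r w ∈ w.adicCompletionIntegers K := by
    intro w
    rw [hr, finiteAdele_sub_apply, sum_finiteAdeleSingleHom_apply]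
    split_ifs with hw
    · rw [sub_self]; exact zero_mem _
    · rw [sub_zero]; exact hS w hw
  have hb : b = ∑ v ∈ S, finiteAdeleSingleHom K v (b v) + r := by rw [hr]; abel
  have key : finiteAdeleAddChar K (∑ v ∈ S, finiteAdeleSingleHom K v (b v) + r) = ∏ v ∈ S, adeleAddCharAt K v (b v) := by
    rw [finiteAdeleAddChar_eq_comp, map_add, map_sum, AddChar.map_add_eq_mul, adeleAddChar_finiteAdeleInr_eq_one K hrint,
      mul_one, AddChar.map_finset_sum_eq_prod]
    refine Finset.prod_congr rfl fun v _ => ?_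
    rw [adeleAddCharAt_apply, adeleSingleHom_eq_finiteAdeleInr]
  rw [← hb] at key
  exact key

/-! ## §2 Local components of finite adelic vectors -/

section LocalComponents

variable {K} {ι : Type} [Fintype ι]

/-- the `v`-component of a finite adelic vector. [folklore] -/
def locVec (x : ι → FiniteAdeleRing (𝓞 K) K) (v : HeightOneSpectrum (𝓞 K)) : ι → v.adicCompletion K :=
  fun i => x i v

omit [Fintype ι] in
/-- unfolding of the local component. [cite: Tate1967, §3.1] -/
@[simp] theorem locVec_apply (x : ι → FiniteAdeleRing (𝓞 K) K) (v : HeightOneSpectrum (𝓞 K)) (i : ι) :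
    locVec x v i = x i v := rfl

omit [Fintype ι] in
/-- `locVec` is additive. [cite: Tate1967, §3.1] -/
theorem locVec_add (x y : ι → FiniteAdeleRing (𝓞 K) K) (v : HeightOneSpectrum (𝓞 K)) :
    locVec (x + y) v = locVec x v + locVec y v := by
  funext i; rfl

/-- components of a dot product of finite adelic vectors. [cite: Tate1967, §3.1] -/
theorem dotProduct_apply_eq_locVec (c b : ι → FiniteAdeleRing (𝓞 K) K) (v : HeightOneSpectrum (𝓞 K)) :
    (∑ i, c i * b i) v = locVec c v ⬝ᵥ locVec b v := by
  rw [finiteAdele_sum_apply]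
  rfl

/-- the local component of a rational matrix acting on a finite adelic vector:
`((T ⊗ 1) y)_v = (T ⊗_F F_v) y_v`. [cite: Weil1964, Chap. III n° 37 p. 188] -/
theorem locVec_mulVec_map {N : ℕ} (T : Matrix (Fin N) (Fin N) K) (y : Fin N → FiniteAdeleRing (𝓞 K) K)
    (v : HeightOneSpectrum (𝓞 K)) :
    locVec (T.map (algebraMap K (FiniteAdeleRing (𝓞 K) K)) *ᵥ y) v =
      T.map (algebraMap K (v.adicCompletion K)) *ᵥ locVec y v := by
  funext i
  simp only [locVec_apply, Matrix.mulVec, dotProduct, Matrix.map_apply, finiteAdele_sum_apply]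
  refine Finset.sum_congr rfl fun j _ => ?_
  change (algebraMap K (FiniteAdeleRing (𝓞 K) K) (T i j) * y j) v = _
  rw [show (algebraMap K (FiniteAdeleRing (𝓞 K) K) (T i j) * y j) v =
      algebraMap K (FiniteAdeleRing (𝓞 K) K) (T i j) v * y j v from rfl, FiniteAdeleRing.algebraMap_apply]
  rfl

/-- a finite adelic vector is integral outside a finite set of places. [cite: Tate1967, §3.1] -/
theorem exists_finset_integral (x : ι → FiniteAdeleRing (𝓞 K) K) :
    ∃ S : Finset (HeightOneSpectrum (𝓞 K)), ∀ v ∉ S, ∀ i, x i v ∈ v.adicCompletionIntegers K := by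
  classical
  have h : ∀ i, ∃ S : Finset (HeightOneSpectrum (𝓞 K)), ∀ v ∉ S, x i v ∈ v.adicCompletionIntegers K := by
    intro i
    have hx : ∀ᶠ v in Filter.cofinite, x i v ∈ v.adicCompletionIntegers K := (x i).2
    rw [Filter.eventually_cofinite] at hx
    exact ⟨hx.toFinset, fun v hv => by_contra fun h => hv (hx.mem_toFinset.2 h)⟩
  choose S hS using h
  exact ⟨Finset.univ.biUnion S, fun v hv i => hS i v fun h => hv (Finset.mem_biUnion.2 ⟨i, Finset.mem_univ i, h⟩)⟩

end LocalComponents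

/-! ## §3 The local Schrödinger operators of a finite Heisenberg element and the unit vectors -/

section Local

open Literature.RepresentationTheory.HeisenbergGroup
open Literature.NumberTheory.GelbartRogawski1991.UnitaryDualPair.LocalSplitting
open Literature.NumberTheory.Weil1964

variable {K} {N : ℕ} (T : Matrix (Fin N) (Fin N) K) (v : HeightOneSpectrum (𝓞 K))

/-- pointwise formula of the local Schrödinger operator. [cite: MoeglinVignerasWaldspurger1987, Chap. 2 I.4 Exemple (1)] -/
theorem localSchrodinger_apply (h : Heisenberg (polar (localPairing K N T v)))
    (f : SchwartzBruhat (Fin N → v.adicCompletion K)) (u : Fin N → v.adicCompletion K) :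
    ((localSchrodinger K N T v h f : SchwartzBruhat (Fin N → v.adicCompletion K)) : (Fin N → v.adicCompletion K) → ℂ) u =
      ((adeleAddCharAt K v (h.t + u ⬝ᵥ localGram K N T v *ᵥ h.v.2) : Circle) : ℂ) *
        (f : (Fin N → v.adicCompletion K) → ℂ) (u + h.v.1) := by
  rw [localSchrodinger, schrodingerSB_apply, Matrix.toLinearMap₂'_apply']

/-- **the local Heisenberg element `((x_v, y_v), 0)` fixes `1_{𝒪_v^N}` when `x_v` and `𝕋_v y_v` are integral**
(`ψ_v` is trivial on `𝒪_v`). [cite: Weil1964, Chap. III n° 37 p. 188] -/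
theorem localSchrodinger_unitVec {x y : Fin N → v.adicCompletion K} (hx : ∀ i, x i ∈ v.adicCompletionIntegers K)
    (hy : ∀ i, (localGram K N T v *ᵥ y) i ∈ v.adicCompletionIntegers K) :
    localSchrodinger K N T v ⟨(x, y), 0⟩ (unitVec K (Fin N) v) = unitVec K (Fin N) v := by
  apply Subtype.ext
  funext u
  rw [localSchrodinger_apply]
  change ((adeleAddCharAt K v (0 + u ⬝ᵥ localGram K N T v *ᵥ y) : Circle) : ℂ) *
      (unitVec K (Fin N) v : (Fin N → v.adicCompletion K) → ℂ) (u + x) = _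
  by_cases hu : u ∈ integralBox K (Fin N) v
  · have hux : u + x ∈ integralBox K (Fin N) v :=
      (mem_integralBox_iff).2 fun i => add_mem ((mem_integralBox_iff).1 hu i) (hx i)
    have hint : u ⬝ᵥ localGram K N T v *ᵥ y ∈ v.adicCompletionIntegers K :=
      sum_mem fun i _ => mul_mem ((mem_integralBox_iff).1 hu i) (hy i)
    rw [zero_add, unitVec_apply_of_mem hux, unitVec_apply_of_mem hu, adeleAddCharAt_eq_one_of_mem K v hint, Circle.coe_one,
      one_mul]
  · have hux : u + x ∉ integralBox K (Fin N) v := fun h => hu ((mem_integralBox_iff).2 fun i => by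
      have := sub_mem ((mem_integralBox_iff).1 h i) (hx i)
      rwa [Pi.add_apply, add_sub_cancel_right] at this)
    rw [unitVec_apply_of_notMem hux, unitVec_apply_of_notMem hu, mul_zero]

end Local

/-! ## §4 The finite operator of a finite Heisenberg element acts factorwise on pure tensors -/

section Factorwise

open Literature.RepresentationTheory.HeisenbergGroup
open Literature.NumberTheory.GelbartRogawski1991.UnitaryDualPair.LocalSplitting
open Literature.NumberTheory.Weil1964

variable {K} {N : ℕ} (T : Matrix (Fin N) (Fin N) K)

/-- the local component at `v` of a Heisenberg element `h = ((x, y), t)` of `W_𝔸` (central part dropped):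
`((x_v, y_v), 0)`. [folklore] -/
def heisLoc (h : AdelicHeisenberg K (Fin N) (T.map (algebraMap K (AdeleRing (𝓞 K) K)))) (v : HeightOneSpectrum (𝓞 K)) :
    Heisenberg (polar (localPairing K N T v)) :=
  ⟨(locVec (piFinite K (Fin N) h.v.1) v, locVec (piFinite K (Fin N) h.v.2) v), 0⟩

/-- **the family `v ↦ ρ_v(h_v) Φ_v` is again a restricted family** (almost all factors are the unit vector).
[cite: Weil1964, Chap. III n° 37 p. 188] -/
theorem eventually_localSchrodinger_heisLoc_eq_unitVec
    (h : AdelicHeisenberg K (Fin N) (T.map (algebraMap K (AdeleRing (𝓞 K) K)))) (Φ : LocalSBFamily K (Fin N)) :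
    ∀ᶠ v in Filter.cofinite, localSchrodinger K N T v (heisLoc T h v) (Φ v) ∈ ({unitVec K (Fin N) v} : Set _) := by
  obtain ⟨Sx, hSx⟩ := exists_finset_integral (piFinite K (Fin N) h.v.1)
  obtain ⟨Sy, hSy⟩ := exists_finset_integral
    ((T.map (algebraMap K (FiniteAdeleRing (𝓞 K) K))) *ᵥ piFinite K (Fin N) h.v.2)
  refine (Φ.2.and (Sx.eventually_cofinite_notMem.and Sy.eventually_cofinite_notMem)).mono fun v hv => ?_
  obtain ⟨h1, h2, h3⟩ := hv
  have h1' : Φ v = unitVec K (Fin N) v := h1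
  rw [Set.mem_singleton_iff, h1']
  refine localSchrodinger_unitVec T v (fun i => hSx v h2 i) fun i => ?_
  have := hSy v h3 i
  rwa [← locVec_apply ((T.map (algebraMap K (FiniteAdeleRing (𝓞 K) K))) *ᵥ piFinite K (Fin N) h.v.2) v i,
    locVec_mulVec_map] at this

/-- the restricted family `(ρ_v(h_v) Φ_v)_v`. [folklore] -/
def heisFamily (h : AdelicHeisenberg K (Fin N) (T.map (algebraMap K (AdeleRing (𝓞 K) K)))) (Φ : LocalSBFamily K (Fin N)) :
    LocalSBFamily K (Fin N) :=
  ⟨fun v => localSchrodinger K N T v (heisLoc T h v) (Φ v), eventually_localSchrodinger_heisLoc_eq_unitVec T h Φ⟩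

/-- unfolding of `heisFamily`. [cite: Weil1964, Chap. III n° 37 p. 188] -/
@[simp] theorem heisFamily_apply (h : AdelicHeisenberg K (Fin N) (T.map (algebraMap K (AdeleRing (𝓞 K) K))))
    (Φ : LocalSBFamily K (Fin N)) (v : HeightOneSpectrum (𝓞 K)) :
    heisFamily T h Φ v = localSchrodinger K N T v (heisLoc T h v) (Φ v) := rfl

/-- the finite part of `(T ⊗ 1) y` is `(T ⊗ 1) y_f`. [cite: Weil1964, Chap. III n° 37 p. 188] -/
theorem piFinite_mulVec_map (y : Fin N → AdeleRing (𝓞 K) K) :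
    piFinite K (Fin N) (T.map (algebraMap K (AdeleRing (𝓞 K) K)) *ᵥ y) =
      T.map (algebraMap K (FiniteAdeleRing (𝓞 K) K)) *ᵥ piFinite K (Fin N) y := by
  funext i
  rw [piFinite_apply]
  change ((∑ j, algebraMap K (AdeleRing (𝓞 K) K) (T i j) * y j : AdeleRing (𝓞 K) K)).2 =
    ∑ j, algebraMap K (FiniteAdeleRing (𝓞 K) K) (T i j) * (y j).2
  exact (map_sum (RingHom.snd (InfiniteAdeleRing K) (FiniteAdeleRing (𝓞 K) K)) _ _).trans
    (Finset.sum_congr rfl fun j _ => rfl)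

/-- **THE FINITE OPERATOR OF A FINITE HEISENBERG ELEMENT ACTS FACTORWISE**: for `h = ((x, y), t) ∈ finHeisenberg`,
`(M_{(Ty)_f} ∘ T_{x_f}) (⊗_v Φ_v) = ⊗_v ρ_v((x_v, y_v), 0) Φ_v`. [cite: Weil1964, Chap. III n° 37 p. 188] -/
theorem finOp_piProdSB {h : AdelicHeisenberg K (Fin N) (T.map (algebraMap K (AdeleRing (𝓞 K) K)))}
    (Φ : LocalSBFamily K (Fin N)) :
    finOp (T.map (algebraMap K (AdeleRing (𝓞 K) K))) h (piProdSB K (Fin N) Φ) = piProdSB K (Fin N) (heisFamily T h Φ) := by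
  classical
  apply Subtype.ext
  funext b
  -- a finite set of places outside which everything is integral and `Φ_v = 1_{𝒪_v^N}`
  obtain ⟨Sx, hSx⟩ := exists_finset_integral (piFinite K (Fin N) h.v.1)
  obtain ⟨Sy, hSy⟩ := exists_finset_integral
    ((T.map (algebraMap K (FiniteAdeleRing (𝓞 K) K))) *ᵥ piFinite K (Fin N) h.v.2)
  obtain ⟨Sb, hSb⟩ := exists_finset_integral b
  set S : Finset (HeightOneSpectrum (𝓞 K)) := (finite_setOf_ne_unitVec Φ).toFinset ∪ Sx ∪ Sy ∪ Sb with hSdef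
  have hΦS : ∀ v ∉ S, Φ v = unitVec K (Fin N) v := fun v hv => by
    by_contra hne
    exact hv (Finset.mem_union_left _ (Finset.mem_union_left _ (Finset.mem_union_left _
      ((finite_setOf_ne_unitVec Φ).mem_toFinset.2 hne))))
  have hxS : ∀ v ∉ S, ∀ i, piFinite K (Fin N) h.v.1 i v ∈ v.adicCompletionIntegers K := fun v hv =>
    hSx v fun hv' => hv (Finset.mem_union_left _ (Finset.mem_union_left _ (Finset.mem_union_right _ hv')))
  have hyS : ∀ v ∉ S, ∀ i, ((T.map (algebraMap K (FiniteAdeleRing (𝓞 K) K))) *ᵥ piFinite K (Fin N) h.v.2) i v ∈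
      v.adicCompletionIntegers K := fun v hv =>
    hSy v fun hv' => hv (Finset.mem_union_left _ (Finset.mem_union_right _ hv'))
  have hbS : ∀ v ∉ S, ∀ i, b i v ∈ v.adicCompletionIntegers K := fun v hv =>
    hSb v fun hv' => hv (Finset.mem_union_right _ hv')
  -- left-hand side
  rw [finOp_def, LinearMap.comp_apply, coe_finModulateSB_apply, coe_finTranslateSB_apply, coe_piProdSB, coe_piProdSB]
  beta_reduce
  rw [piFinite_mulVec_map]
  have hdotS : ∀ v ∉ S, (∑ i, (T.map (algebraMap K (FiniteAdeleRing (𝓞 K) K)) *ᵥ piFinite K (Fin N) h.v.2) i * b i) v ∈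
      v.adicCompletionIntegers K := fun v hv => by
    rw [finiteAdele_sum_apply]
    exact sum_mem fun i _ => mul_mem (hyS v hv i) (hbS v hv i)
  have hunit : ∀ v ∉ S, heisFamily T h Φ v = unitVec K (Fin N) v := fun v hv => by
    rw [heisFamily_apply, hΦS v hv]
    refine localSchrodinger_unitVec T v (hxS v hv) fun i => ?_
    have := hyS v hv i
    rwa [← locVec_apply ((T.map (algebraMap K (FiniteAdeleRing (𝓞 K) K))) *ᵥ piFinite K (Fin N) h.v.2) v i,
      locVec_mulVec_map] at this
  rw [finiteAdeleAddChar_eq_prod K _ S hdotS,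
    piProd_eq_prod Φ (piFinite K (Fin N) h.v.1 + b) S hΦS (fun v hv i => add_mem (hxS v hv i) (hbS v hv i)),
    piProd_eq_prod (heisFamily T h Φ) b S hunit hbS, ← Circle.coeHom_apply, map_prod, ← Finset.prod_mul_distrib]
  refine Finset.prod_congr rfl fun v _ => ?_
  rw [Circle.coeHom_apply, localFactor_apply, localFactor_apply, heisFamily_apply, localSchrodinger_apply]
  change _ = ((adeleAddCharAt K v (0 + _) : Circle) : ℂ) * _
  rw [zero_add, dotProduct_apply_eq_locVec, dotProduct_comm, locVec_mulVec_map]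
  refine congrArg₂ (· * ·) rfl (congrArg _ (funext fun i => ?_))
  change (piFinite K (Fin N) h.v.1 i + b i) v = b i v + piFinite K (Fin N) h.v.1 i v
  exact (congrArg (fun f : FiniteAdeleRing (𝓞 K) K => f v) (add_comm _ _)).trans rfl

end Factorwise

end Literature.NumberTheory.Automorphic

end
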